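import Summits.BirchSwinnertonDyer.BirchSwinnertonDyer.Theorems.ClassRecordThreeCornerAtThreeWOfInputsR22
import Summits.BirchSwinnertonDyer.BirchSwinnertonDyer.Theorems.ClassRecordThreeCornerAtThreeR23ItemStatements
import Summits.BirchSwinnertonDyer.BirchSwinnertonDyer.Theses.ClassRecordThree
import Summits.BirchSwinnertonDyer.BirchSwinnertonDyer.Theses.KolyvaginRoadThree
import HarnessLib

/-!
# Crux 21420 `CornerAtThreeW` — the RULING 80 GLUE item 23544 `CornerAtThreeWGlue` (children ⟹ parent) MODULO the seven other route items,
# BY NAME on both @3 routes (cell `bsd-stepL`, seat `bsd-stepL-corner3-p2` g16 = lane B; `--supports stmt-BirchSwinnertonDyer-23544 --as helper`)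

`CornerAtThreeWGlue := KatoTwinFactsThreeOutside → ShimuraPrimitivesAtThreeGuardedFact → ShimuraPrimitivesWithSplitNormTDAtThree →
CornerFHTwinLowerSupplyAtThree → CornerTwinLowerModEightAtThree → CornerTwistMuAnAtThree → CornerAtThreeW` (plan g43 RULING 80 (c)/(d): CR3 rev 43 item
23544 rank 707, KR3 rev 41 rank 807). It is NOT provable outright (it would prove the corner crux from its six children alone); it holds MODULO the seven other
route items the r23 composition binds — `PublishedInputsThree` (19112), `ShimuraParametrizationDataNonempty` (19524), `EulerHalfGrossPrintFacts` (27981),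
`CornerStepLLeafAtThree` (19408), `PastenComponentOrdersInput` (19716), `ShimuraPrimitivesAtThreeInertFact` (23177), `ShimuraCurveGrossZagierKolyvagin` (19526) —
by lane B g16's closer `CornerAtThreeWOfInputs.cornerAtThreeW_of_itemsR22K` (p665549 + p667259), exactly as the zero-stub r23 of
`Cruxes/CornerAtThreeW/Lines/inert.lean` (dcd2fdc46f391e6b). RULING 67 (a) pattern (corner-p1's `nonSurjCornerOfItems_of_items` on ER5).

HONEST FRAMING: two bookkeeping theorems (argument reshuffles of the landed closer); CONDITIONAL on the seven items; the glue item stays ledger-open modulo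
items; nothing booked; no census label moves (T7); BSD is proved for no curve.
-/

set_option linter.dupNamespace false
set_option autoImplicit false

noncomputable section

namespace Summit.BirchSwinnertonDyer.BirchSwinnertonDyer.Theorems.CornerAtThreeWOfInputs

/-- **Glue item 23544 `Theses.ClassRecordThree.CornerAtThreeWGlue` MODULO the seven other route items of the r23 composition, BY NAME.** One line over
`cornerAtThreeW_of_itemsR22K`. CONDITIONAL; the glue item does NOT close by this file (RULING 67 (a): open modulo items).
[cite: JetchevSkinnerWan2017, §7.4.1–§7.4.2] [cite: GrossLMS1991, Prop. 3.7 (2), §6] [cite: Darmon2004, Prop. 3.10, Def. 3.12, Thm. 4.18] -/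
theorem cornerAtThreeWGlue_of_items
    (hP : Summit.BirchSwinnertonDyer.BirchSwinnertonDyer.Theses.ClassRecordThree.PublishedInputsThree)
    (hJL : Summit.BirchSwinnertonDyer.BirchSwinnertonDyer.Theses.ClassRecordThree.ShimuraParametrizationDataNonempty)
    (hF2 : Summit.BirchSwinnertonDyer.BirchSwinnertonDyer.Theses.ClassRecordThree.EulerHalfGrossPrintFacts)
    (hS : Summit.BirchSwinnertonDyer.BirchSwinnertonDyer.Theses.ClassRecordThree.CornerStepLLeafAtThree)
    (hCO : Summit.BirchSwinnertonDyer.BirchSwinnertonDyer.Theses.ClassRecordThree.PastenComponentOrdersInput)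
    (hPrim : Summit.BirchSwinnertonDyer.BirchSwinnertonDyer.Theses.ClassRecordThree.ShimuraPrimitivesAtThreeInertFact)
    (hGZK : Summit.BirchSwinnertonDyer.BirchSwinnertonDyer.Theses.ClassRecordThree.ShimuraCurveGrossZagierKolyvagin) :
    Summit.BirchSwinnertonDyer.BirchSwinnertonDyer.Theses.ClassRecordThree.CornerAtThreeWGlue :=
  fun hKato8 hPrimG hres hTL3 hT8 hμ ↦
    cornerAtThreeW_of_itemsR22K hP hJL hF2 hS hCO hPrim hGZK hT8 hμ hKato8 hPrimG hTL3 hres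

/-- **The `KolyvaginRoadThree` twin: glue item 23544 (shared by dedup) `Theses.KolyvaginRoadThree.CornerAtThreeWGlue` MODULO the seven other items, BY NAME**
(KR3 names; `PublishedInputsThree` from CR3 as in every r16–r23 twin). CONDITIONAL; nothing booked. [cite: Darmon2004, Prop. 3.10, Def. 3.12, Thm. 4.18] -/
theorem kolyvaginRoadThree_cornerAtThreeWGlue_of_items
    (hP : Summit.BirchSwinnertonDyer.BirchSwinnertonDyer.Theses.ClassRecordThree.PublishedInputsThree)
    (hJL : Summit.BirchSwinnertonDyer.BirchSwinnertonDyer.Theses.KolyvaginRoadThree.ShimuraParametrizationDataNonempty)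
    (hF2 : Summit.BirchSwinnertonDyer.BirchSwinnertonDyer.Theses.KolyvaginRoadThree.EulerHalfGrossPrintFacts)
    (hS : Summit.BirchSwinnertonDyer.BirchSwinnertonDyer.Theses.KolyvaginRoadThree.CornerStepLLeafAtThree)
    (hCO : Summit.BirchSwinnertonDyer.BirchSwinnertonDyer.Theses.KolyvaginRoadThree.PastenComponentOrdersInput)
    (hPrim : Summit.BirchSwinnertonDyer.BirchSwinnertonDyer.Theses.KolyvaginRoadThree.ShimuraPrimitivesAtThreeInertFact)
    (hGZK : Summit.BirchSwinnertonDyer.BirchSwinnertonDyer.Theses.KolyvaginRoadThree.ShimuraCurveGrossZagierKolyvagin) :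
    Summit.BirchSwinnertonDyer.BirchSwinnertonDyer.Theses.KolyvaginRoadThree.CornerAtThreeWGlue :=
  fun hKato8 hPrimG hres hTL3 hT8 hμ ↦
    kolyvaginRoadThree_cornerAtThreeW_of_itemsR22K hP hJL hF2 hS hCO hPrim hGZK hT8 hμ hKato8 hPrimG hTL3 hres

end Summit.BirchSwinnertonDyer.BirchSwinnertonDyer.Theorems.CornerAtThreeWOfInputs

end
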